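import Summits.KontsevichZagierPeriods.KontsevichZagierPeriods.Theorems.RootDecompOrderCutAdicStagesP1

/-! # `RootDecompOrderCutAdicStagesP2` — part 2/5 of the mechanical ≤350-line split of `src.lean`
(split by the decomp-kz census seat for landing; mathematics unchanged; part 2 continues part 1). -/

noncomputable section
open Literature.NumberTheory.Transcendental Literature.NumberTheory.Transcendental.KZ
open Summit.KontsevichZagierPeriods.KontsevichZagierPeriods.Theses
open Summit.KontsevichZagierPeriods.RootDecompPureDefect
open Summit.KontsevichZagierPeriods.RootDecompOrderCut
open Polynomial

namespace Summit.KontsevichZagierPeriods.RootDecompAdicStages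

/-- RATIONAL FORM of `AdicSeparated`: classes of non-zero RATIONAL value are non-zero-divisors. -/
theorem adicSeparated_iff_ratCancellation :
    AdicSeparated ↔ ∀ (m x : FormalPeriodRing) (q : ℚ), q ≠ 0 → evalP m = q → m * x = 0 → x = 0 := by
  constructor
  · intro h m x q hq hm hmx
    have hnum : q.num ≠ 0 := Rat.num_ne_zero.mpr hq
    have hval : evalP ((q.den : FormalPeriodRing) * m) = (q.num : ℝ) := by
      rw [map_mul, map_natCast, hm]; exact_mod_cast Rat.den_mul_eq_num q
    obtain ⟨i, hi, hix⟩ := exists_fix_of_intCast_mul_eq hnum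
      (j := (q.num : FormalPeriodRing) - (q.den : FormalPeriodRing) * m)
      (by rw [map_sub, hval, map_intCast, sub_self]) (by rw [sub_mul, mul_assoc, hmx, mul_zero, sub_zero])
    exact h x i hi hix
  · intro h x i hi hix
    exact h (1 - i) x 1 one_ne_zero (by rw [map_sub, map_one, hi, sub_zero, Rat.cast_one])
      (by rw [sub_mul, one_mul, hix, sub_self])

/-- If `s·x = 0` then `q(s)·x = q(0)·x` for every integer polynomial `q`. -/
theorem eval₂_mul_eq_coeff_zero_mul {s x : FormalPeriodRing} (hsx : s * x = 0) (q : ℤ[X]) :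
    Polynomial.eval₂ (Int.castRingHom FormalPeriodRing) s q * x = (q.coeff 0 : FormalPeriodRing) * x := by
  conv_lhs => rw [← Polynomial.divX_mul_X_add q]
  rw [Polynomial.eval₂_add, Polynomial.eval₂_mul, Polynomial.eval₂_X, Polynomial.eval₂_C, add_mul, mul_assoc,
    hsx, mul_zero, zero_add, eq_intCast]

/-- Values commute with integer polynomials: `v (q(s)) = q(v s)`. -/
theorem evalP_eval₂ (s : FormalPeriodRing) (q : ℤ[X]) :
    evalP (Polynomial.eval₂ (Int.castRingHom FormalPeriodRing) s q) = Polynomial.eval₂ (Int.castRingHom ℝ) (evalP s) q := by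
  rw [Polynomial.hom_eval₂, RingHom.ext_int (evalP.comp (Int.castRingHom FormalPeriodRing)) (Int.castRingHom ℝ)]

/-- A non-zero real algebraic number is a root of an integer polynomial with NON-ZERO CONSTANT TERM. -/
theorem exists_intPoly_coeff_zero_ne_zero {α : ℝ} (hα : IsAlgebraic ℚ α) (hα0 : α ≠ 0) :
    ∃ q : ℤ[X], q.coeff 0 ≠ 0 ∧ Polynomial.eval₂ (Int.castRingHom ℝ) α q = 0 := by
  obtain ⟨p, hp, hpα⟩ := (IsFractionRing.isAlgebraic_iff ℤ ℚ ℝ).mpr hα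
  obtain ⟨q, hpq, hq⟩ := Polynomial.exists_eq_pow_rootMultiplicity_mul_and_not_dvd p hp 0
  rw [map_zero, sub_zero] at hpq hq
  refine ⟨q, fun h0 => hq (Polynomial.X_dvd_iff.mpr h0), ?_⟩
  have h1 : Polynomial.eval₂ (Int.castRingHom ℝ) α p = 0 := by
    rwa [Polynomial.aeval_def, algebraMap_int_eq] at hpα
  rw [hpq, Polynomial.eval₂_mul, Polynomial.eval₂_X_pow] at h1
  exact (mul_eq_zero.mp h1).resolve_left (pow_ne_zero _ hα0)

/-- ALGEBRAIC FORM of `AdicDefect` — **KZ's conjecture up to a multiplier of non-zero ALGEBRAIC value**: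
every defect is killed by a class whose value is a non-zero algebraic number (minimal-polynomial trick
`q(s)·x = q(0)·x`, `v q(s) = q(α) = 0`, `q(0) ∈ ℤ ∖ 0` a unit of `P`). -/
theorem adicDefect_iff_algTorsion :
    AdicDefect ↔ ∀ x : FormalPeriodRing, evalP x = 0 →
      ∃ s : FormalPeriodRing, IsAlgebraic ℚ (evalP s) ∧ evalP s ≠ 0 ∧ s * x = 0 := by
  constructor
  · intro h x hx
    obtain ⟨m, hm, hmx⟩ := adicDefect_iff_torsionOne.mp h x hx
    exact ⟨m, by rw [hm]; exact isAlgebraic_one, by rw [hm]; exact one_ne_zero, hmx⟩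
  · intro h x hx
    obtain ⟨s, hs, hs0, hsx⟩ := h x hx
    obtain ⟨q, hq0, hqα⟩ := exists_intPoly_coeff_zero_ne_zero hs hs0
    refine exists_fix_of_intCast_mul_eq hq0 (j := Polynomial.eval₂ (Int.castRingHom FormalPeriodRing) s q)
      (by rw [evalP_eval₂, hqα]) ?_
    rw [eval₂_mul_eq_coeff_zero_mul hsx]

/-- ALGEBRAIC FORM of `AdicSeparated`: classes of non-zero ALGEBRAIC value are non-zero-divisors. -/
theorem adicSeparated_iff_algCancellation :
    AdicSeparated ↔ ∀ s x : FormalPeriodRing, IsAlgebraic ℚ (evalP s) → evalP s ≠ 0 → s * x = 0 → x = 0 := by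
  constructor
  · intro h s x hs hs0 hsx
    obtain ⟨q, hq0, hqα⟩ := exists_intPoly_coeff_zero_ne_zero hs hs0
    obtain ⟨i, hi, hix⟩ := exists_fix_of_intCast_mul_eq hq0
      (j := Polynomial.eval₂ (Int.castRingHom FormalPeriodRing) s q) (by rw [evalP_eval₂, hqα])
      (by rw [eval₂_mul_eq_coeff_zero_mul hsx])
    exact h x i hi hix
  · intro h x i hi hix
    exact h (1 - i) x (by rw [map_sub, map_one, hi, sub_zero]; exact isAlgebraic_one)
      (by rw [map_sub, map_one, hi, sub_zero]; exact one_ne_zero) (by rw [sub_mul, one_mul, hix, sub_self])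

/-! ## 5. Finite stages: Krull's intersection theorem as the bridge -/

/-- The defect ideal of a stage `A ⊆ P`: `𝔭_A = 𝔭 ∩ A = ker (v|_A)`. -/
abbrev stageIdeal (A : Subring FormalPeriodRing) : Ideal A := RingHom.ker (evalP.comp A.subtype)

/-- `A` is `𝔭_A`-ADICALLY SEPARATED: the adic kernel `κ(A) = ⋂ₙ 𝔭_Aⁿ` is zero. -/
def StageSeparated (A : Subring FormalPeriodRing) : Prop := ∀ x : A, (∀ n : ℕ, x ∈ stageIdeal A ^ n) → x = 0

/-- Membership in `stageIdeal`, unfolded. [bookkeeping] -/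
theorem mem_stageIdeal {A : Subring FormalPeriodRing} {x : A} : x ∈ stageIdeal A ↔ evalP (x : FormalPeriodRing) = 0 :=
  RingHom.mem_ker

/-- Easy half (no Noetherian hypothesis): a class fixed by a defect OF THE STAGE lies in the adic kernel. -/
theorem mem_pow_of_fix {A : Subring FormalPeriodRing} {x i : A} (hi : evalP (i : FormalPeriodRing) = 0)
    (hix : i * x = x) (n : ℕ) : x ∈ stageIdeal A ^ n := by
  rw [← Iface.pow_mul_eq_of_fix hix n]
  exact Ideal.mul_mem_right _ _ (Ideal.pow_mem_pow (mem_stageIdeal.mpr hi) n)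

/-- **KRULL AT A NOETHERIAN STAGE (the bridge)**: `x ∈ ⋂ₙ 𝔭_Aⁿ ⟺ ∃ i ∈ 𝔭_A, i·x = x`
(Mathlib's Artin–Rees form `Ideal.mem_iInf_smul_pow_eq_bot_iff`). -/
theorem mem_adicKernel_iff (A : Subring FormalPeriodRing) [IsNoetherianRing A] (x : A) :
    (∀ n : ℕ, x ∈ stageIdeal A ^ n) ↔ ∃ i : A, evalP (i : FormalPeriodRing) = 0 ∧ i * x = x := by
  have key := Ideal.mem_iInf_smul_pow_eq_bot_iff (stageIdeal A) (M := A) x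
  have e : (x ∈ (⨅ n : ℕ, stageIdeal A ^ n • ⊤ : Submodule A A)) ↔ ∀ n : ℕ, x ∈ stageIdeal A ^ n := by
    rw [Submodule.mem_iInf]
    refine forall_congr' fun n => ?_
    rw [Ideal.smul_eq_mul, Ideal.mul_top]
  rw [← e, key]
  constructor
  · rintro ⟨⟨i, hi⟩, h⟩; exact ⟨i, mem_stageIdeal.mp hi, h⟩
  · rintro ⟨i, hi, h⟩; exact ⟨⟨i, mem_stageIdeal.mpr hi⟩, h⟩

/-- Finitely generated stages are Noetherian (Hilbert's basis theorem, Mathlib). -/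
theorem isNoetherianRing_stage (F : Finset FormalPeriodRing) :
    IsNoetherianRing (Subring.closure (↑F : Set FormalPeriodRing)) :=
  is_noetherian_subring_closure _ F.finite_toSet

/-- `AdicSeparated ⟹` every NOETHERIAN stage is adically separated. -/
theorem stageSeparated_of_adicSeparated (h : AdicSeparated) (A : Subring FormalPeriodRing) [IsNoetherianRing A] :
    StageSeparated A := fun x hx => by
  obtain ⟨i, hi, hix⟩ := (mem_adicKernel_iff A x).mp hx
  have : (x : FormalPeriodRing) = 0 := h x i hi (by rw [← Subring.coe_mul, hix])
  exact_mod_cast this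

/-- **FINITE-STAGE FORM of `AdicSeparated`**: `1 + 𝔭` is regular on `P` iff EVERY finitely generated stage
`ℤ[F] ⊆ P` is `𝔭`-adically separated. -/
theorem adicSeparated_iff_stages :
    AdicSeparated ↔ ∀ F : Finset FormalPeriodRing, StageSeparated (Subring.closure (↑F : Set FormalPeriodRing)) := by
  classical
  constructor
  · intro h F
    haveI := isNoetherianRing_stage F
    exact stageSeparated_of_adicSeparated h _
  · intro h x i hi hix
    let A := Subring.closure (↑({x, i} : Finset FormalPeriodRing) : Set FormalPeriodRing)
    have hxA : x ∈ A := Subring.subset_closure (by simp)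
    have hiA : i ∈ A := Subring.subset_closure (by simp)
    have hfix : (⟨i, hiA⟩ : A) * ⟨x, hxA⟩ = ⟨x, hxA⟩ := Subtype.ext hix
    have h0 := h {x, i} ⟨x, hxA⟩ (mem_pow_of_fix (A := A) (i := ⟨i, hiA⟩) hi hfix)
    exact congrArg Subtype.val h0

/-- The same with all Noetherian stages. -/
theorem adicSeparated_iff_noetherianStages :
    AdicSeparated ↔ ∀ A : Subring FormalPeriodRing, IsNoetherianRing A → StageSeparated A := by
  constructor
  · intro h A hA; haveI := hA; exact stageSeparated_of_adicSeparated h A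
  · intro h
    exact adicSeparated_iff_stages.mpr fun F => h _ (isNoetherianRing_stage F)

/-- **FINITE-STAGE FORM of `AdicDefect`**: every defect lies in the adic kernel `⋂ₙ 𝔭_Aⁿ` of SOME finitely generated
stage containing it (it dies in that stage's `𝔭`-adic completion). -/
theorem adicDefect_iff_stages :
    AdicDefect ↔ ∀ x : FormalPeriodRing, evalP x = 0 → ∃ (F : Finset FormalPeriodRing)
      (hx : x ∈ Subring.closure (↑F : Set FormalPeriodRing)),
      ∀ n : ℕ, (⟨x, hx⟩ : Subring.closure (↑F : Set FormalPeriodRing)) ∈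
        stageIdeal (Subring.closure (↑F : Set FormalPeriodRing)) ^ n := by
  classical
  constructor
  · intro h x hx
    obtain ⟨i, hi, hix⟩ := h x hx
    let A := Subring.closure (↑({x, i} : Finset FormalPeriodRing) : Set FormalPeriodRing)
    have hxA : x ∈ A := Subring.subset_closure (by simp)
    have hiA : i ∈ A := Subring.subset_closure (by simp)
    have hfix : (⟨i, hiA⟩ : A) * ⟨x, hxA⟩ = ⟨x, hxA⟩ := Subtype.ext hix
    exact ⟨{x, i}, hxA, mem_pow_of_fix (A := A) (i := ⟨i, hiA⟩) hi hfix⟩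
  · intro h x hx
    obtain ⟨F, hxF, hn⟩ := h x hx
    haveI := isNoetherianRing_stage F
    obtain ⟨i, hi, hix⟩ := (mem_adicKernel_iff _ _).mp hn
    exact ⟨i, hi, by simpa using congrArg Subtype.val hix⟩

/-- **`S` AT FINITE STAGES**: KZ's conjecture ⟺ (every finitely generated stage of `P` is `𝔭`-adically separated) ∧
(every defect dies `𝔭`-adically in some finitely generated stage). -/
theorem summit_iff_stages :
    _root_.KontsevichZagierPeriods ↔
      (∀ x : FormalPeriodRing, evalP x = 0 → ∃ (F : Finset FormalPeriodRing)
        (hx : x ∈ Subring.closure (↑F : Set FormalPeriodRing)),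
        ∀ n : ℕ, (⟨x, hx⟩ : Subring.closure (↑F : Set FormalPeriodRing)) ∈
          stageIdeal (Subring.closure (↑F : Set FormalPeriodRing)) ^ n) ∧
      (∀ F : Finset FormalPeriodRing, StageSeparated (Subring.closure (↑F : Set FormalPeriodRing))) := by
  rw [summit_iff_adic, adicDefect_iff_stages, adicSeparated_iff_stages]

/-- THE BASE STAGE `ℤ[ϖ]` meets the defect ideal trivially (Lindemann, tree `evalP_polyPi_ne_zero`). -/
theorem defect_base_stage (y : FormalPeriodRing) (hy : y ∈ Subring.closure ({piClass} : Set FormalPeriodRing))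
    (hv : evalP y = 0) : y = 0 := by
  have hle : Subring.closure ({piClass} : Set FormalPeriodRing) ≤
      (Polynomial.eval₂RingHom (Int.castRingHom FormalPeriodRing) piClass).range := by
    rw [Subring.closure_le]
    intro z hz
    rw [Set.mem_singleton_iff] at hz
    subst hz
    exact ⟨Polynomial.X, by simp⟩
  obtain ⟨u, rfl⟩ := hle hy
  by_cases hu : u = 0
  · rw [hu, map_zero]
  · exact absurd hv (by rw [Polynomial.coe_eval₂RingHom]; exact evalP_polyPi_ne_zero hu)

/-- Hence the base stage is adically separated (indeed `𝔭_{ℤ[ϖ]} = 0`). -/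
theorem stageSeparated_base : StageSeparated (Subring.closure ({piClass} : Set FormalPeriodRing)) := fun x hx => by
  have h1 : x ∈ stageIdeal _ := by simpa [pow_one] using hx 1
  exact Subtype.ext (defect_base_stage x x.2 (mem_stageIdeal.mp h1))

/-! ## 6. Edges on `P`: the exchange lattice -/

/-- `FlatDefect ⟹ AdicDefect`. -/
theorem adicDefect_of_flatDefect (h : FlatDefect) : AdicDefect := Iface.adicDefect_of_flat h

/-- `AdicDefect ⟹ LocTriv`. -/
theorem locTriv_of_adicDefect (h : AdicDefect) : LocTriv := Iface.locTriv_of_adicDefect h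

/-- **`PiFlatDefect` (item 27508, by name) `⟹ LocTriv`** (`s = ϖᵏ − x·h`). -/
theorem locTriv_of_piFlatDefect (h : RootDecompPureDefect.PiFlatDefect) : LocTriv :=
  Iface.locTriv_of_piFlat (ϖ := piClass) (by rw [evalP_piClass]; exact Real.pi_ne_zero) h

/-- 0541-form `⟹ LocTriv`. -/
theorem locTriv_of_piPowerDefect (h : PiPowerDefect) : LocTriv :=
  Iface.locTriv_of_piPower (ϖ := piClass) (by rw [evalP_piClass]; exact Real.pi_ne_zero) h

/-- **UNCONDITIONAL: a class killed by a multiplier of POSITIVE value has its square in `T ∩ −T`**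
(`(M+1)·g = 1 + c`, `posCertificate`; `x² + c·x² = 0`). -/
theorem sq_mem_supp_of_pos_torsion {g x : FormalPeriodRing} (hg : 0 < evalP g) (hgx : g * x = 0) :
    x * x ∈ posCone ∧ -(x * x) ∈ posCone := by
  obtain ⟨M, c, hc, hM⟩ := posCertificate' g hg
  have h1 : x * x + c * (x * x) = 0 := by
    have h2 : ((M : FormalPeriodRing) + 1) * g * (x * x) = 0 := by
      rw [mul_assoc, ← mul_assoc g, hgx, zero_mul, mul_zero]
    rw [hM, add_mul, one_mul] at h2
    exact h2
  exact ⟨sq_mem_posCone x, by rw [neg_eq_of_add_eq_zero_right h1]; exact mul_sq_mem_posCone_of_pos hc x⟩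

/-- The same for a multiplier of non-zero value (replace `g` by `−g`). -/
theorem sq_mem_supp_of_torsion {g x : FormalPeriodRing} (hg : evalP g ≠ 0) (hgx : g * x = 0) :
    x * x ∈ posCone ∧ -(x * x) ∈ posCone := by
  rcases lt_or_gt_of_ne hg with hneg | hpos
  · exact sq_mem_supp_of_pos_torsion (g := -g) (by rw [map_neg]; linarith) (by rw [neg_mul, hgx, neg_zero])
  · exact sq_mem_supp_of_pos_torsion hpos hgx

/-- In particular for a multiplier of value one. -/
theorem sq_mem_supp_of_torsionOne {m x : FormalPeriodRing} (hm : evalP m = 1) (hmx : m * x = 0) :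
    x * x ∈ posCone ∧ -(x * x) ∈ posCone :=
  sq_mem_supp_of_pos_torsion (by rw [hm]; exact one_pos) hmx

/-- **NEW FEEDER OF ROUTE O's DECIDING CRUX: `LocTriv ⟹ DefectNegligible` (item 32161, by name)** with exponent
`m = 0` and slack `t = c·x²`. Hence also `AdicDefect ⟹ DN`, and (again) `PiFlatDefect ⟹ DN`. -/
theorem defectNegligible_of_locTriv (h : LocTriv) : RootDecompOrderCut.DefectNegligible := by
  rw [defectNegligible_iff_posCone]
  intro x hx
  obtain ⟨s, hs, hsx⟩ := h x hx
  have key : ∀ g : FormalPeriodRing, 0 < evalP g → g * x = 0 →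
      ∃ (m : ℕ) (t : FormalPeriodRing), t ∈ posCone ∧ x ^ (2 * (m + 1)) + t = 0 := by
    intro g hg hgx
    obtain ⟨M, c, hc, hM⟩ := posCertificate' g hg
    refine ⟨0, c * (x * x), mul_sq_mem_posCone_of_pos hc x, ?_⟩
    have h2 : ((M : FormalPeriodRing) + 1) * g * (x * x) = 0 := by
      rw [mul_assoc, ← mul_assoc g, hgx, zero_mul, mul_zero]
    rw [hM] at h2
    calc x ^ (2 * (0 + 1)) + c * (x * x) = (1 + c) * (x * x) := by ring
      _ = 0 := h2
  rcases lt_or_gt_of_ne hs with hneg | hpos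
  · exact key (-s) (by rw [map_neg]; linarith) (by rw [neg_mul, hsx, neg_zero])
  · exact key s hpos hsx

/-- Auxiliary step `defectNegligible_of_adicDefect`. [bookkeeping] -/
theorem defectNegligible_of_adicDefect (h : AdicDefect) : RootDecompOrderCut.DefectNegligible :=
  defectNegligible_of_locTriv (locTriv_of_adicDefect h)

/-- `AdicDefect ⟹ KernelIdempotent` (g12's left half is BELOW the new one). -/
theorem kernelIdempotent_of_adicDefect (h : AdicDefect) : KernelIdempotent := Iface.kernelIdempotent_of_adicDefect h

/-- `Cancellation ⟹ AdicSeparated`. -/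
theorem adicSeparated_of_cancellation (h : Cancellation) : AdicSeparated := Iface.adicSeparated_of_cancellation h

/-- **`ProperCone ∧ ReducedPeriodRing` (items 31891, 3929, by name) `⟹ Cancellation ⟹ AdicSeparated`**
(tree `cancellation_of_order`). -/
theorem cancellation_of_order' (hP : RootDecompOrderCut.ProperCone) (hR : RootDecompOrderCut.ReducedPeriodRing) : Cancellation :=
  cancellation_of_order hP hR

/-- Auxiliary step `adicSeparated_of_order`. [bookkeeping] -/
theorem adicSeparated_of_order (hP : RootDecompOrderCut.ProperCone) (hR : RootDecompOrderCut.ReducedPeriodRing) : AdicSeparated :=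
  adicSeparated_of_cancellation (cancellation_of_order hP hR)

/-- `KrullSeparated ⟹ AdicSeparated` (g12's right half is ABOVE the new one). -/
theorem adicSeparated_of_krullSeparated (h : KrullSeparated) : AdicSeparated := Iface.adicSeparated_of_krull h

/-- `AdicSeparated ⟹ Connected`. -/
theorem connected_of_adicSeparated (h : AdicSeparated) : Connected := Iface.connected_of_adicSeparated h

end Summit.KontsevichZagierPeriods.RootDecompAdicStages
end
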